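import Mathlib
import Literature.NumberTheory.LFunctions.WeilArchimedeanMoments
import Literature.NumberTheory.LFunctions.WeilSemilocalCompactnessProofs

/-!
# The Fourier-grid window estimate (Yoshida 1992, §6 (6.4), finite form)

Literature/NumberTheory/LFunctions.  H. Yoshida, *On Hermitian forms attached to zeta functions*,
Adv. Stud. Pure Math. **21** (1992) 281–325 [cite: Yoshida1992HermitianForms, §3 Lemma 3 and §6 (6.3)–(6.4)]:
the complement spaces `K_N(a) = {φ ∈ K(a) : ∫_{-a}^{a} φ(x) e^{-iπnx/a} dx = 0, |n| ≤ N}` are coercive for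
Weil's form because the transform of such a `φ` is small at low frequencies — Yoshida expands `φ` in the
Fourier basis `χ_n` of `L²([-a, a])` and bounds `|φ̂(t)|` through `Σ_{|n|>N} |χ̂_n(t)|²` (proof of Lemma 3,
pp. 290–291, and (6.4) p. 303).

This file proves the FINITE (projection) form of that estimate for the tree's test functions, with an
arbitrary finite set `S` of grid indices in place of `{|n| ≤ N}`:

* `re_inner_le_of_fourierGrid_zero` — for `tsupport g ⊆ [-a, a]` and `ĝ(1/2 + iπn/a) = 0` (`n ∈ S`), every
  `μ ∈ ℂ` and all coefficients `λ : ℤ → ℂ`: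
  `2 Re(conj μ · ĝ(1/2+it)) ≤ ‖g‖₂² + |μ|² ∫_{-a}^{a} |e^{itx} − Σ_{n∈S} λ_n e^{iπnx/a}|² dx`
  (the distance from `g` to the line through `conj` of the trial function is non-negative, and the trial
  function pairs with `g` to `ĝ(1/2+it)` because the grid values vanish);
* `norm_sq_weilMellin_le_of_fourierGrid_zero` — hence (Cauchy–Schwarz)
  `|ĝ(1/2+it)|² ≤ ‖g‖₂² · ∫_{-a}^{a} |e^{itx} − Σ_{n∈S} λ_n e^{iπnx/a}|² dx` for EVERY `λ`;
* `intervalIntegral_norm_sq_cexp_sub_sum` — the closed form of that integral,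
  `2a − 2 Re Σ_n conj(λ_n) σ_n(t) + 2a Σ_n |λ_n|²`, `σ_n(t) = ∫_{-a}^{a} e^{i(t − πn/a)x} dx`
  (orthogonality `∫_{-a}^{a} e^{iπ(m-n)x/a} dx = 2a δ_{nm}`; the exponential integrals are private helpers);
* `norm_sq_weilMellin_le_of_fourierGrid_zero_proj` / `…_sinc` — the optimal choice `λ_n = σ_n(t)/2a`:
  `|ĝ(1/2+it)|² ≤ ‖g‖₂² · (2a − (1/2a) Σ_{n∈S} σ_n(t)²)`, `σ_n(t) = 2 sin((t − πn/a)a)/(t − πn/a)`.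

By Parseval for `e^{itx}` on `[-a, a]` (`Σ_{n∈ℤ} |σ_n(t)|² = 4a²`) the last bound is Yoshida's
`|φ̂(t)|² ≤ (1/2a) ‖φ‖² Σ_{n∉S} |σ_n(t)|²`; the finite form needs no series and is what a kernel-checked
certificate evaluates.  This is the Fourier-grid counterpart of the fine-grid window estimate
`norm_sq_weilMellin_le_of_grid_zero` (`WeilFiniteCodimension.lean`) and the analytic input "H3" (complement
coercivity with an explicit constant) of Fourier–Galerkin / Schur certificates of `WeilPositivityOn a`
(Yoshida §6).  RH-free; no definitions, no named facts.
-/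

noncomputable section

open Complex Set MeasureTheory Filter
open scoped Real Topology ComplexConjugate

namespace Literature.NumberTheory.LFunctions

variable {g : ℝ → ℂ}

/-! ### Exponential integrals on `[-a, a]` -/

/-- `∫_{-a}^{a} e^{icx} dx = 2 sin(ca)/c` for real `c ≠ 0`. [folklore] -/
private theorem intervalIntegral_cexp_mul_I {a c : ℝ} (hc : c ≠ 0) :
    ∫ x in (-a)..a, cexp (c * I * x) = ((2 * Real.sin (c * a) / c : ℝ) : ℂ) := by
  have hc' : (c : ℂ) * I ≠ 0 := mul_ne_zero (ofReal_ne_zero.mpr hc) I_ne_zero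
  rw [integral_exp_mul_complex hc']
  have e1 : (c : ℂ) * I * (a : ℝ) = (c * a : ℝ) * I := by push_cast; ring
  have e2 : (c : ℂ) * I * (-a : ℝ) = -((c * a : ℝ)) * I := by push_cast; ring
  rw [e1, e2]
  have hsin : cexp ((c * a : ℝ) * I) - cexp (-(c * a : ℝ) * I) = 2 * I * Complex.sin (c * a : ℝ) := by
    rw [Complex.sin]
    linear_combination (cexp ((c * a : ℝ) * I) - cexp (-(c * a : ℝ) * I)) * I_mul_I
  rw [hsin, ← Complex.ofReal_sin]
  have hI : (I : ℂ) ≠ 0 := I_ne_zero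
  have hc0 : (c : ℂ) ≠ 0 := ofReal_ne_zero.mpr hc
  push_cast
  field_simp

/-- `∫_{-a}^{a} e^{i0x} dx = 2a`. [folklore] -/
private theorem intervalIntegral_cexp_zero_mul (a : ℝ) :
    ∫ x in (-a)..a, cexp ((0 : ℝ) * I * x) = ((2 * a : ℝ) : ℂ) := by
  simp only [ofReal_zero, zero_mul, Complex.exp_zero]
  rw [intervalIntegral.integral_const]
  simp
  ring

/-- Orthogonality of the window exponentials: for integers `n ≠ m` and `a ≠ 0`,
`∫_{-a}^{a} e^{iπ(m−n)x/a} dx = 0`. [folklore] -/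
private theorem intervalIntegral_cexp_grid_sub_eq_zero {a : ℝ} (ha : a ≠ 0) {n m : ℤ} (hnm : n ≠ m) :
    ∫ x in (-a)..a, cexp ((π * (m - n) / a : ℝ) * I * x) = 0 := by
  have hk : ((m : ℝ) - n) ≠ 0 := by
    have : (m : ℝ) ≠ n := by exact_mod_cast (Ne.symm hnm)
    exact sub_ne_zero.mpr this
  have hc : (π * (m - n) / a : ℝ) ≠ 0 := by
    refine div_ne_zero (mul_ne_zero Real.pi_ne_zero ?_) ha
    exact_mod_cast hk
  rw [intervalIntegral_cexp_mul_I hc]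
  have hsin : Real.sin (π * (m - n) / a * a) = 0 := by
    rw [div_mul_cancel₀ _ ha]
    have : π * ((m : ℝ) - n) = ((m - n : ℤ) : ℝ) * π := by push_cast; ring
    rw [this]
    exact Real.sin_int_mul_pi _
  rw [hsin]
  simp

/-! ### The grid-zero pairing and the Bessel / Cauchy–Schwarz step -/

/-- If `ĝ` vanishes at the grid points `πn/a`, `n ∈ S`, then `g` pairs with
`h(x) = e^{itx} − Σ_{n∈S} λ_n e^{iπnx/a}` to `ĝ(1/2 + it)`, whatever the coefficients `λ`. [folklore] -/
private theorem integral_mul_cexp_sub_sum_eq_weilMellin (hg : IsWeilTest g) {a : ℝ} (S : Finset ℤ)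
    (hzero : ∀ n ∈ S, weilMellin g (1 / 2 + ((π * n / a : ℝ) : ℂ) * I) = 0) (lam : ℤ → ℂ) (t : ℝ) :
    ∫ x : ℝ, g x * (cexp (t * I * x) - ∑ n ∈ S, lam n * cexp ((π * n / a : ℝ) * I * x))
      = weilMellin g (1 / 2 + t * I) := by
  have hgc : Continuous g := hg.1.continuous
  have hexpc : ∀ c : ℝ, Continuous fun x : ℝ ↦ cexp (c * I * x) := fun c ↦ by fun_prop
  have i0 : Integrable fun x : ℝ ↦ g x * cexp (t * I * x) := hg.integrable_mul (hexpc t)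
  have iS : ∀ n : ℤ, Integrable fun x : ℝ ↦ g x * (lam n * cexp ((π * n / a : ℝ) * I * x)) :=
    fun n ↦ hg.integrable_mul (continuous_const.mul (hexpc _))
  have e1 : (fun x : ℝ ↦ g x * (cexp (t * I * x) - ∑ n ∈ S, lam n * cexp ((π * n / a : ℝ) * I * x)))
      = fun x ↦ g x * cexp (t * I * x) - ∑ n ∈ S, g x * (lam n * cexp ((π * n / a : ℝ) * I * x)) := by
    funext x
    rw [mul_sub, Finset.mul_sum]
  rw [e1, integral_sub i0 (integrable_finsetSum _ fun n _ ↦ iS n),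
    integral_finsetSum _ fun n _ ↦ iS n, weilMellin_half_line_eq]
  have hv : ∀ n ∈ S, ∫ x : ℝ, g x * (lam n * cexp ((π * n / a : ℝ) * I * x)) = 0 := by
    intro n hn
    have e2 : (fun x : ℝ ↦ g x * (lam n * cexp ((π * n / a : ℝ) * I * x)))
        = fun x ↦ lam n * (g x * cexp ((π * n / a : ℝ) * I * x)) := by
      funext x; ring
    rw [e2, integral_const_mul, ← weilMellin_half_line_eq, hzero n hn, mul_zero]
  rw [Finset.sum_eq_zero hv, sub_zero]

/-- **Bessel form of the grid estimate.**  For `tsupport g ⊆ [-a, a]`, `ĝ(1/2 + iπn/a) = 0` (`n ∈ S`),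
any `μ ∈ ℂ`, `t ∈ ℝ` and coefficients `λ`:
`2 Re(conj μ · ĝ(1/2+it)) ≤ ‖g‖₂² + |μ|² ∫_{-a}^{a} |e^{itx} − Σ_{n∈S} λ_n e^{iπnx/a}|² dx`
(`0 ≤ ∫_{-a}^{a} |g − μ conj h|²`). [cite: Yoshida1992HermitianForms, §6 (6.4) (finite projection form)] -/
theorem re_inner_le_of_fourierGrid_zero (hg : IsWeilTest g) {a : ℝ} (ha : 0 < a)
    (hsupp : tsupport g ⊆ Icc (-a) a) (S : Finset ℤ)
    (hzero : ∀ n ∈ S, weilMellin g (1 / 2 + ((π * n / a : ℝ) : ℂ) * I) = 0)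
    (lam : ℤ → ℂ) (t : ℝ) (μ : ℂ) :
    2 * (conj μ * weilMellin g (1 / 2 + t * I)).re ≤
      weilNorm2Sq g + ‖μ‖ ^ 2 *
        ∫ x in (-a)..a, ‖cexp (t * I * x) - ∑ n ∈ S, lam n * cexp ((π * n / a : ℝ) * I * x)‖ ^ 2 := by
  have hgc : Continuous g := hg.1.continuous
  have hab : -a ≤ a := by linarith
  set h : ℝ → ℂ := fun x ↦ cexp (t * I * x) - ∑ n ∈ S, lam n * cexp ((π * n / a : ℝ) * I * x) with hh
  have hhc : Continuous h := by
    rw [hh]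
    exact (by fun_prop : Continuous fun x : ℝ ↦ cexp (t * I * x)).sub
      (continuous_finsetSum _ fun n _ ↦ by fun_prop)
  set Q : ℝ → ℂ := fun x ↦ μ * conj (h x) with hQ
  have hQc : Continuous Q := continuous_const.mul (Complex.continuous_conj.comp hhc)
  have hQs : Continuous fun x ↦ conj (Q x) := Complex.continuous_conj.comp hQc
  -- (1) `0 ≤ ∫_{-a}^{a} ‖g - Q‖²`
  have h0 : 0 ≤ ∫ x in (-a)..a, ‖g x - Q x‖ ^ 2 :=
    intervalIntegral.integral_nonneg hab fun x _ ↦ sq_nonneg _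
  -- (2) expand the square
  have i1 : IntervalIntegrable (fun x ↦ ‖g x‖ ^ 2) volume (-a) a :=
    ((hgc.norm).pow 2).intervalIntegrable _ _
  have i2 : IntervalIntegrable (fun x ↦ ‖Q x‖ ^ 2) volume (-a) a :=
    ((hQc.norm).pow 2).intervalIntegrable _ _
  have iGQ : IntervalIntegrable (fun x ↦ g x * conj (Q x)) volume (-a) a :=
    (hgc.mul hQs).intervalIntegrable _ _
  have i3 : IntervalIntegrable (fun x ↦ 2 * (g x * conj (Q x)).re) volume (-a) a :=
    (continuous_const.mul (Complex.continuous_re.comp (hgc.mul hQs))).intervalIntegrable _ _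
  have hexp : ∫ x in (-a)..a, ‖g x - Q x‖ ^ 2 =
      (∫ x in (-a)..a, ‖g x‖ ^ 2) + (∫ x in (-a)..a, ‖Q x‖ ^ 2) -
        2 * ∫ x in (-a)..a, (g x * conj (Q x)).re := by
    simp_rw [norm_sub_sq_complex]
    rw [intervalIntegral.integral_sub (i1.add i2) i3, intervalIntegral.integral_add i1 i2,
      intervalIntegral.integral_const_mul]
  -- (3) `∫_{-a}^{a} ‖g‖² = ‖g‖₂²`
  have hN : ∫ x in (-a)..a, ‖g x‖ ^ 2 = weilNorm2Sq g := by
    rw [weilNorm2Sq]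
    apply intervalIntegral.integral_eq_integral_of_support_subset
    intro x hx
    have hgx : g x ≠ 0 := fun h0 ↦ hx (by simp [h0])
    exact Ioo_subset_Ioc_self (support_subset_Ioo_of_tsupport_subset_Icc hgc hsupp hgx)
  -- `∫ Re = Re ∫` on `[-a, a]`
  have hre : ∀ {F : ℝ → ℂ}, IntervalIntegrable F volume (-a) a →
      ∫ x in (-a)..a, (F x).re = (∫ x in (-a)..a, F x).re := by
    intro F hF
    have := ContinuousLinearMap.intervalIntegral_comp_comm Complex.reCLM hF
    simpa only [Complex.reCLM_apply] using this
  -- (4) the cross term: `∫ g conj(Q) = conj μ · ĝ(1/2+it)`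
  have hcross : ∫ x in (-a)..a, (g x * conj (Q x)).re =
      (conj μ * weilMellin g (1 / 2 + t * I)).re := by
    rw [hre iGQ]
    congr 1
    have e1 : (fun x ↦ g x * conj (Q x)) = fun x ↦ conj μ * (g x * h x) := by
      funext x
      rw [hQ]
      simp only [map_mul, Complex.conj_conj]
      ring
    rw [e1, intervalIntegral.integral_const_mul]
    congr 1
    rw [← integral_eq_intervalIntegral_of_tsupport hgc hsupp h, hh]
    exact integral_mul_cexp_sub_sum_eq_weilMellin hg S hzero lam t
  -- (5) the trial term: `∫ ‖Q‖² = |μ|² ∫ ‖h‖²`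
  have hQQ : ∫ x in (-a)..a, ‖Q x‖ ^ 2 = ‖μ‖ ^ 2 * ∫ x in (-a)..a, ‖h x‖ ^ 2 := by
    rw [← intervalIntegral.integral_const_mul]
    refine intervalIntegral.integral_congr fun x _ ↦ ?_
    simp only [hQ, norm_mul, Complex.norm_conj]
    ring
  rw [hexp, hN, hcross, hQQ] at h0
  linarith

/-- **The Fourier-grid window estimate (Cauchy–Schwarz form).**  For `tsupport g ⊆ [-a, a]` and
`ĝ(1/2 + iπn/a) = 0` for `n ∈ S`, for every real `t` and all coefficients `λ`:
`|ĝ(1/2+it)|² ≤ ‖g‖₂² · ∫_{-a}^{a} |e^{itx} − Σ_{n∈S} λ_n e^{iπnx/a}|² dx`.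
(With the optimal `λ` this is the squared distance from `e^{itx}` to the span of the grid exponentials in
`L²[-a, a]`; Yoshida bounds the same quantity by the tail `Σ_{|n|>N} |χ̂_n(t)|²`.) [cite: Yoshida1992HermitianForms, §6 (6.4)] -/
theorem norm_sq_weilMellin_le_of_fourierGrid_zero (hg : IsWeilTest g) {a : ℝ} (ha : 0 < a)
    (hsupp : tsupport g ⊆ Icc (-a) a) (S : Finset ℤ)
    (hzero : ∀ n ∈ S, weilMellin g (1 / 2 + ((π * n / a : ℝ) : ℂ) * I) = 0)
    (lam : ℤ → ℂ) (t : ℝ) :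
    ‖weilMellin g (1 / 2 + t * I)‖ ^ 2 ≤
      weilNorm2Sq g *
        ∫ x in (-a)..a, ‖cexp (t * I * x) - ∑ n ∈ S, lam n * cexp ((π * n / a : ℝ) * I * x)‖ ^ 2 := by
  have key := fun μ : ℂ ↦ re_inner_le_of_fourierGrid_zero hg ha hsupp S hzero lam t μ
  set z : ℂ := weilMellin g (1 / 2 + t * I) with hz
  set H : ℝ := ∫ x in (-a)..a, ‖cexp (t * I * x) - ∑ n ∈ S, lam n * cexp ((π * n / a : ℝ) * I * x)‖ ^ 2
    with hH
  have hG : 0 ≤ weilNorm2Sq g := weilNorm2Sq_nonneg g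
  have hH0 : 0 ≤ H := intervalIntegral.integral_nonneg (by linarith) fun x _ ↦ sq_nonneg _
  -- `conj z · z = |z|²`
  have hzz : ∀ s : ℝ, (conj ((s : ℂ) * z) * z).re = s * ‖z‖ ^ 2 := by
    intro s
    rw [map_mul, Complex.conj_ofReal, mul_assoc, Complex.re_ofReal_mul, Complex.conj_mul',
      ← Complex.ofReal_pow, Complex.ofReal_re]
  rcases eq_or_lt_of_le hH0 with hH | hH
  · -- `H = 0`: take `μ = s z`, `s → ∞`
    have hs : ∀ s : ℝ, 2 * (s * ‖z‖ ^ 2) ≤ weilNorm2Sq g := by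
      intro s
      have := key ((s : ℂ) * z)
      rw [hzz, ← hH, mul_zero, add_zero] at this
      exact this
    have hz0 : ‖z‖ ^ 2 = 0 := by
      by_contra hne
      have hpos : 0 < ‖z‖ ^ 2 := lt_of_le_of_ne (sq_nonneg _) (Ne.symm hne)
      have := hs ((weilNorm2Sq g + 1) / (2 * ‖z‖ ^ 2))
      have hzne : ‖z‖ ≠ 0 := fun h0 ↦ by rw [h0] at hpos; simp at hpos
      have e : 2 * ((weilNorm2Sq g + 1) / (2 * ‖z‖ ^ 2) * ‖z‖ ^ 2) = weilNorm2Sq g + 1 := by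
        field_simp
      linarith
    rw [hz0, ← hH, mul_zero]
  · -- `H > 0`: take `μ = z / H`
    have := key (((1 / H : ℝ) : ℂ) * z)
    rw [hzz, norm_mul, Complex.norm_real, Real.norm_of_nonneg (by positivity), mul_pow] at this
    -- this : 2 * (1/H * ‖z‖²) ≤ G + (1/H)² ‖z‖² * H
    have e : (1 / H) ^ 2 * ‖z‖ ^ 2 * H = 1 / H * ‖z‖ ^ 2 := by
      field_simp
    rw [e] at this
    have h2 : 1 / H * ‖z‖ ^ 2 ≤ weilNorm2Sq g := by linarith
    calc ‖z‖ ^ 2 = H * (1 / H * ‖z‖ ^ 2) := by field_simp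
      _ ≤ H * weilNorm2Sq g := mul_le_mul_of_nonneg_left h2 hH.le
      _ = weilNorm2Sq g * H := mul_comm _ _

/-! ### Closed form of the trial integral and the projection bound -/

/-- `conj (e^{icx}) = e^{-icx}` for real `c, x`. [folklore] -/
private theorem conj_cexp_mul_I (c x : ℝ) : conj (cexp (c * I * x)) = cexp ((-c : ℝ) * I * x) := by
  rw [← Complex.exp_conj]
  congr 1
  simp only [map_mul, Complex.conj_ofReal, Complex.conj_I, ofReal_neg]
  ring

/-- `e^{ic₁x} e^{ic₂x} = e^{i(c₁+c₂)x}` for real `c₁, c₂, x`. [folklore] -/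
private theorem cexp_mul_I_mul_cexp_mul_I (c₁ c₂ x : ℝ) :
    cexp (c₁ * I * x) * cexp (c₂ * I * x) = cexp ((c₁ + c₂ : ℝ) * I * x) := by
  rw [← Complex.exp_add]
  congr 1
  push_cast
  ring

/-- The Gram integrals of the grid exponentials: `∫_{-a}^{a} e^{-iπnx/a} e^{iπmx/a} dx = 2a δ_{nm}`. [folklore] -/
private theorem intervalIntegral_conj_cexp_grid_mul (a : ℝ) (ha : a ≠ 0) (n m : ℤ) :
    ∫ x in (-a)..a, conj (cexp ((π * n / a : ℝ) * I * x)) * cexp ((π * m / a : ℝ) * I * x)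
      = if n = m then ((2 * a : ℝ) : ℂ) else 0 := by
  simp_rw [conj_cexp_mul_I, cexp_mul_I_mul_cexp_mul_I]
  split_ifs with hnm
  · subst hnm
    have : (-(π * n / a) + π * n / a : ℝ) = 0 := by ring
    rw [this, intervalIntegral_cexp_zero_mul]
  · have : (-(π * n / a) + π * m / a : ℝ) = π * (m - n) / a := by ring
    rw [this]
    exact intervalIntegral_cexp_grid_sub_eq_zero ha hnm

/-- **Closed form of the trial integral.**  For `a ≠ 0`, coefficients `λ` and
`σ_n(t) := ∫_{-a}^{a} e^{i(t − πn/a)x} dx`: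
`∫_{-a}^{a} |e^{itx} − Σ_{n∈S} λ_n e^{iπnx/a}|² dx = 2a − 2 Re Σ_{n∈S} conj(λ_n) σ_n(t) + 2a Σ_{n∈S} |λ_n|²`
(orthonormality of Yoshida's Fourier basis `χ_n(x) = (2a)^{-1/2} e^{iπnx/a}` of `L²([-a, a])`, §3 p. 289–290).
[cite: Yoshida1992HermitianForms, §3 pp. 289–290 (the basis χ_n) and §6 (6.4)] -/
theorem intervalIntegral_norm_sq_cexp_sub_sum {a : ℝ} (ha : a ≠ 0) (S : Finset ℤ) (lam : ℤ → ℂ) (t : ℝ) :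
    ∫ x in (-a)..a, ‖cexp (t * I * x) - ∑ n ∈ S, lam n * cexp ((π * n / a : ℝ) * I * x)‖ ^ 2
      = 2 * a - 2 * (∑ n ∈ S, conj (lam n) * ∫ x in (-a)..a, cexp ((t - π * n / a : ℝ) * I * x)).re
          + 2 * a * ∑ n ∈ S, ‖lam n‖ ^ 2 := by
  set e : ℝ → ℂ := fun x ↦ cexp (t * I * x) with he
  set b : ℤ → ℝ → ℂ := fun n x ↦ cexp ((π * n / a : ℝ) * I * x) with hb
  set Q : ℝ → ℂ := fun x ↦ ∑ n ∈ S, lam n * b n x with hQ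
  have hec : Continuous e := by rw [he]; fun_prop
  have hbc : ∀ n, Continuous (b n) := fun n ↦ by rw [hb]; fun_prop
  have hQc : Continuous Q := by
    rw [hQ]; exact continuous_finsetSum _ fun n _ ↦ continuous_const.mul (hbc n)
  have hQs : Continuous fun x ↦ conj (Q x) := Complex.continuous_conj.comp hQc
  -- `∫ Re = Re ∫`
  have hre : ∀ {F : ℝ → ℂ}, IntervalIntegrable F volume (-a) a →
      ∫ x in (-a)..a, (F x).re = (∫ x in (-a)..a, F x).re := by
    intro F hF
    have := ContinuousLinearMap.intervalIntegral_comp_comm Complex.reCLM hF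
    simpa only [Complex.reCLM_apply] using this
  -- expand the square
  have i1 : IntervalIntegrable (fun x ↦ ‖e x‖ ^ 2) volume (-a) a := ((hec.norm).pow 2).intervalIntegrable _ _
  have i2 : IntervalIntegrable (fun x ↦ ‖Q x‖ ^ 2) volume (-a) a := ((hQc.norm).pow 2).intervalIntegrable _ _
  have iEQ : IntervalIntegrable (fun x ↦ e x * conj (Q x)) volume (-a) a := (hec.mul hQs).intervalIntegrable _ _
  have iQQ : IntervalIntegrable (fun x ↦ conj (Q x) * Q x) volume (-a) a := (hQs.mul hQc).intervalIntegrable _ _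
  have i3 : IntervalIntegrable (fun x ↦ 2 * (e x * conj (Q x)).re) volume (-a) a :=
    (continuous_const.mul (Complex.continuous_re.comp (hec.mul hQs))).intervalIntegrable _ _
  have hexp : ∫ x in (-a)..a, ‖e x - Q x‖ ^ 2 =
      (∫ x in (-a)..a, ‖e x‖ ^ 2) + (∫ x in (-a)..a, ‖Q x‖ ^ 2) -
        2 * ∫ x in (-a)..a, (e x * conj (Q x)).re := by
    simp_rw [norm_sub_sq_complex]
    rw [intervalIntegral.integral_sub (i1.add i2) i3, intervalIntegral.integral_add i1 i2,
      intervalIntegral.integral_const_mul]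
  -- `‖e‖² = 1`
  have hE : ∫ x in (-a)..a, ‖e x‖ ^ 2 = 2 * a := by
    have h1 : ∀ x : ℝ, ‖e x‖ ^ 2 = 1 := by
      intro x
      rw [he]
      simp only
      rw [show (t : ℂ) * I * x = ((t * x : ℝ) : ℂ) * I by push_cast; ring, Complex.norm_exp_ofReal_mul_I,
        one_pow]
    simp_rw [h1]
    rw [intervalIntegral.integral_const, smul_eq_mul, mul_one]
    ring
  -- cross term
  have hcross : ∫ x in (-a)..a, (e x * conj (Q x)).re =
      (∑ n ∈ S, conj (lam n) * ∫ x in (-a)..a, cexp ((t - π * n / a : ℝ) * I * x)).re := by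
    rw [hre iEQ]
    congr 1
    have e1 : ∀ x, e x * conj (Q x) = ∑ n ∈ S, conj (lam n) * cexp ((t - π * n / a : ℝ) * I * x) := by
      intro x
      rw [hQ, he, hb]
      simp only [map_sum, map_mul, Finset.mul_sum]
      refine Finset.sum_congr rfl fun n _ ↦ ?_
      rw [conj_cexp_mul_I, show cexp (t * I * x) * (conj (lam n) * cexp ((-(π * n / a) : ℝ) * I * x))
        = conj (lam n) * (cexp (t * I * x) * cexp ((-(π * n / a) : ℝ) * I * x)) by ring,
        cexp_mul_I_mul_cexp_mul_I]
      congr 3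
    simp_rw [e1]
    have iN : ∀ n, IntervalIntegrable (fun x ↦ conj (lam n) * cexp ((t - π * n / a : ℝ) * I * x)) volume (-a) a :=
      fun n ↦ (continuous_const.mul (by fun_prop)).intervalIntegrable _ _
    rw [intervalIntegral.integral_finsetSum fun n _ ↦ iN n]
    refine Finset.sum_congr rfl fun n _ ↦ ?_
    rw [intervalIntegral.integral_const_mul]
  -- Gram term
  have hgram : ∫ x in (-a)..a, ‖Q x‖ ^ 2 = 2 * a * ∑ n ∈ S, ‖lam n‖ ^ 2 := by
    have e1 : ∀ x, (‖Q x‖ ^ 2 : ℝ) = (conj (Q x) * Q x).re := by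
      intro x
      rw [Complex.sq_norm, ← Complex.normSq_eq_conj_mul_self]
      simp
    have e2 : ∀ x, conj (Q x) * Q x =
        ∑ n ∈ S, ∑ m ∈ S, conj (lam n) * lam m * (conj (b n x) * b m x) := by
      intro x
      rw [hQ]
      simp only [map_sum, map_mul]
      rw [Finset.sum_mul_sum]
      refine Finset.sum_congr rfl fun n _ ↦ Finset.sum_congr rfl fun m _ ↦ ?_
      ring
    simp_rw [e1]
    rw [hre iQQ]
    simp_rw [e2]
    have iNM : ∀ n m, IntervalIntegrable (fun x ↦ conj (lam n) * lam m * (conj (b n x) * b m x)) volume (-a) a :=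
      fun n m ↦ (continuous_const.mul ((Complex.continuous_conj.comp (hbc n)).mul (hbc m))).intervalIntegrable _ _
    have iNs : ∀ n, IntervalIntegrable (fun x ↦ ∑ m ∈ S, conj (lam n) * lam m * (conj (b n x) * b m x)) volume (-a) a :=
      fun n ↦ (continuous_finsetSum _ fun m _ ↦
        continuous_const.mul ((Complex.continuous_conj.comp (hbc n)).mul (hbc m))).intervalIntegrable _ _
    rw [intervalIntegral.integral_finsetSum fun n _ ↦ iNs n]
    have hin : ∀ n ∈ S, ∫ x in (-a)..a, ∑ m ∈ S, conj (lam n) * lam m * (conj (b n x) * b m x)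
        = conj (lam n) * lam n * ((2 * a : ℝ) : ℂ) := by
      intro n hn
      rw [intervalIntegral.integral_finsetSum fun m _ ↦ iNM n m]
      have hm : ∀ m ∈ S, ∫ x in (-a)..a, conj (lam n) * lam m * (conj (b n x) * b m x)
          = if n = m then conj (lam n) * lam n * ((2 * a : ℝ) : ℂ) else 0 := by
        intro m _
        rw [intervalIntegral.integral_const_mul, hb]
        simp only
        rw [intervalIntegral_conj_cexp_grid_mul a ha n m]
        split_ifs with h
        · subst h; rfl
        · rw [mul_zero]
      rw [Finset.sum_congr rfl hm, Finset.sum_ite_eq S n, if_pos hn]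
    rw [Finset.sum_congr rfl hin, ← Finset.sum_mul, Complex.re_mul_ofReal]
    have h3 : (∑ n ∈ S, conj (lam n) * lam n).re = ∑ n ∈ S, ‖lam n‖ ^ 2 := by
      rw [Complex.re_sum]
      refine Finset.sum_congr rfl fun n _ ↦ ?_
      rw [Complex.conj_mul', ← Complex.ofReal_pow, Complex.ofReal_re]
    rw [h3]
    ring
  have hlhs : (fun x : ℝ ↦ ‖cexp (t * I * x) - ∑ n ∈ S, lam n * cexp ((π * n / a : ℝ) * I * x)‖ ^ 2)
      = fun x : ℝ ↦ ‖e x - Q x‖ ^ 2 := by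
    funext x; rw [he, hQ, hb]
  rw [hlhs, hexp, hE, hcross, hgram]
  ring

/-- **The Fourier-grid window estimate, projection form** (Yoshida (6.4), finite version).  For
`tsupport g ⊆ [-a, a]`, `ĝ(1/2 + iπn/a) = 0` for `n ∈ S`, and real numbers `s_n` with
`∫_{-a}^{a} e^{i(t − πn/a)x} dx = s_n` (`s_n = 2 sin((t − πn/a)a)/(t − πn/a)`, or `2a` at the grid point;
`intervalIntegral_cexp_mul_I`, `intervalIntegral_cexp_zero_mul`):
`|ĝ(1/2+it)|² ≤ ‖g‖₂² · (2a − (1/2a) Σ_{n∈S} s_n²)`.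
(Choice `λ_n = s_n/2a` in `norm_sq_weilMellin_le_of_fourierGrid_zero`; by Parseval the bracket equals
`(1/2a) Σ_{n∉S} s_n²`, Yoshida's tail sum.) [cite: Yoshida1992HermitianForms, §6 (6.4)] -/
theorem norm_sq_weilMellin_le_of_fourierGrid_zero_proj (hg : IsWeilTest g) {a : ℝ} (ha : 0 < a)
    (hsupp : tsupport g ⊆ Icc (-a) a) (S : Finset ℤ)
    (hzero : ∀ n ∈ S, weilMellin g (1 / 2 + ((π * n / a : ℝ) : ℂ) * I) = 0) (t : ℝ)
    (s : ℤ → ℝ) (hs : ∀ n ∈ S, ∫ x in (-a)..a, cexp ((t - π * n / a : ℝ) * I * x) = (s n : ℂ)) :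
    ‖weilMellin g (1 / 2 + t * I)‖ ^ 2 ≤
      weilNorm2Sq g * (2 * a - 1 / (2 * a) * ∑ n ∈ S, s n ^ 2) := by
  have h := norm_sq_weilMellin_le_of_fourierGrid_zero hg ha hsupp S hzero (fun n ↦ ((s n / (2 * a) : ℝ) : ℂ)) t
  rw [intervalIntegral_norm_sq_cexp_sub_sum ha.ne' S _ t] at h
  have hsum1 : (∑ n ∈ S, conj (((s n / (2 * a) : ℝ) : ℂ)) * ∫ x in (-a)..a, cexp ((t - π * n / a : ℝ) * I * x)).re
      = ∑ n ∈ S, s n / (2 * a) * s n := by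
    rw [Complex.re_sum]
    refine Finset.sum_congr rfl fun n hn ↦ ?_
    rw [hs n hn, Complex.conj_ofReal, ← Complex.ofReal_mul, Complex.ofReal_re]
  have hsum2 : ∑ n ∈ S, ‖(((s n / (2 * a) : ℝ) : ℂ))‖ ^ 2 = ∑ n ∈ S, (s n / (2 * a)) ^ 2 := by
    refine Finset.sum_congr rfl fun n _ ↦ ?_
    rw [Complex.norm_real, Real.norm_eq_abs, sq_abs]
  rw [hsum1, hsum2] at h
  have e : 2 * a - 2 * ∑ n ∈ S, s n / (2 * a) * s n + 2 * a * ∑ n ∈ S, (s n / (2 * a)) ^ 2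
      = 2 * a - 1 / (2 * a) * ∑ n ∈ S, s n ^ 2 := by
    rw [Finset.mul_sum, Finset.mul_sum, Finset.mul_sum]
    have : ∀ n ∈ S, 2 * (s n / (2 * a) * s n) = 1 / (2 * a) * s n ^ 2 + 1 / (2 * a) * s n ^ 2 := by
      intro n _; field_simp; ring
    have h2 : ∀ n ∈ S, 2 * a * (s n / (2 * a)) ^ 2 = 1 / (2 * a) * s n ^ 2 := by
      intro n _; field_simp
    rw [Finset.sum_congr rfl this, Finset.sum_congr rfl h2, Finset.sum_add_distrib]
    ring
  rw [e] at h
  exact h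

/-- **The Fourier-grid window estimate, explicit form.**  For `tsupport g ⊆ [-a, a]` and
`ĝ(1/2 + iπn/a) = 0` for `n ∈ S`:
`|ĝ(1/2+it)|² ≤ ‖g‖₂² · (2a − (1/2a) Σ_{n∈S} s_n(t)²)` with
`s_n(t) = 2 sin((t − πn/a)a)/(t − πn/a)` (`= 2a` when `t = πn/a`) — the transform of the window's
indicator at `t − πn/a`.  [cite: Yoshida1992HermitianForms, §6 (6.4) (finite projection form)] -/
theorem norm_sq_weilMellin_le_of_fourierGrid_zero_sinc (hg : IsWeilTest g) {a : ℝ} (ha : 0 < a)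
    (hsupp : tsupport g ⊆ Icc (-a) a) (S : Finset ℤ)
    (hzero : ∀ n ∈ S, weilMellin g (1 / 2 + ((π * n / a : ℝ) : ℂ) * I) = 0) (t : ℝ) :
    ‖weilMellin g (1 / 2 + t * I)‖ ^ 2 ≤
      weilNorm2Sq g * (2 * a - 1 / (2 * a) * ∑ n ∈ S,
        (if t = π * n / a then 2 * a else 2 * Real.sin ((t - π * n / a) * a) / (t - π * n / a)) ^ 2) := by
  refine norm_sq_weilMellin_le_of_fourierGrid_zero_proj hg ha hsupp S hzero t _ fun n _ ↦ ?_
  split_ifs with h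
  · have : (t - π * n / a : ℝ) = 0 := by rw [h]; ring
    rw [this, intervalIntegral_cexp_zero_mul]
  · exact intervalIntegral_cexp_mul_I (sub_ne_zero.mpr h)

end Literature.NumberTheory.LFunctions
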